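import Summits.ResolutionOfSingularities.ResolutionOfSingularities.Theorems.FrobeniusClosingPatchingRelPerfectTangentEuclidCharts
import HarnessLib

/-!
# Crux `PatchingRelPerfect` (stmt-ResolutionOfSingularities-16161), chain w52 — rung tool
# TANGENT EUCLID, part 2: the tower for `K = (η t + cᵏ) + (t^β)` (ring level, any regular ring)

[OURS · L1 W5.2 · rung tool, kernel (iii) support] Assembly of part 1
(`…TangentEuclidCharts.lean`: chart images of `K = (η t + cᵏ) + (t^β)` and of the avatars
`(η t + cᵏ)ⁱ + (cⁱ⁺ʲ)` on the two Rees charts of `Bl_{(t,c)} Spec R`, and the re-lettering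
`(c, h′)`, `h′ = η τ + cᵏ⁻¹`, weakly regular with regular quotient) with stub-1's Euclidean tower
`CoreRungTower.euclid_exponents` (`…CoreRungTowerEuclid.lean`) and stub-4's chartwise assembly
`isRegular_of_isBlowup_mul_of_charts` (Stacks 080A): the maximal-contact hypersurface
`H = V(η t + cᵏ)` (`η` a unit, `k ≥ 2`) is regular but TANGENT to `E = V(t)` along `V(t, c)`, so
Euclid does not apply to `(t, h)`; ONE blowing up of the reduced tangency locus `V(t, c)` makes
`(c, h′)` transversal and `K · B_c = c · ((h′) + (c^{kβ-1}))`, while on the `t`-chart everything is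
the Cartier divisor `(t^N)`.  This is the finishing step of the simplest NON-GRADED member
`(x₃² + x₀³) + 𝔪⁴` of the core's hunt family (CHAIN v1.5 §4 kernel (iii); hand route in this
seat's note `NONGRADED-CUSP-MEMBER.md`, evidence #52 on the crux item), a phenomenon absent from
graded one-form members.  PROVED, every regular ring, no dimension / characteristic /
residue-field hypothesis:

* `CoreRungTower.tangent_euclid_exponents` — for all `k ≥ 2`, `β ≥ 1` there is a list `L` of
  exponent pairs such that for every regular ring `R`, every unit `η`, every quasi-regular pair
  `(t, c)` with `R/(t, c)` a regular ring, every blowing up of `Spec R` along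
  `((η t + cᵏ) + (t^β)) · ∏_{(i,j) ∈ L} ((η t + cᵏ)ⁱ + (cⁱ⁺ʲ)) · (t, c)` is a regular scheme.

FORMAT evidence / a tool for kernel-(iii) certificates (CHAIN §1 (A)); nothing here is a statement of
the manuscript under review.

## References

* Q. Liu, *Algebraic Geometry and Arithmetic Curves*, OUP 2002, Thm. 8.1.19 (a). [Liu2002]
* The Stacks Project, Tags 080A, 080B, 0804, 0BIQ. [StacksProject]
* O. Zariski, P. Samuel, *Commutative Algebra II*, Appendix 5. [ZariskiSamuel1960]
-/

-- `Summit.<Summit>.<Sub>.Theorems` with `Sub = Summit` (single-conjunct summit, D-0017)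
set_option linter.dupNamespace false

noncomputable section

open CategoryTheory CategoryTheory.Limits AlgebraicGeometry Literature.AlgebraicGeometry.Resolution

namespace Summit.ResolutionOfSingularities.ResolutionOfSingularities.Theorems

universe u

namespace CoreRungTower

/-! ## The tower -/

set_option maxHeartbeats 400000 in
/-- **TANGENT EUCLID (ring level).** For all `k ≥ 2` and `β ≥ 1` there is a list `L` of exponent
pairs such that for every regular ring `R`, every unit `η`, every quasi-regular pair `(t, c)` with
`R/(t, c)` a regular ring, every blowing up of `Spec R` along
`((η t + cᵏ) + (t^β)) · ∏_{(i,j) ∈ L} ((η t + cᵏ)ⁱ + (cⁱ⁺ʲ)) · (t, c)` is a regular scheme — the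
blowing up of the reduced tangency locus `V(t, c)` of the regular hypersurface `H = V(η t + cᵏ)`
with `E = V(t)`, followed (on the `c`-chart, where `(c, h′)` is transversal) by the Euclidean tower
of `(h′) + (c^{kβ-1})` (`euclid_exponents 1 (kβ - 1)`); on the `t`-chart everything is Cartier.
[cite: Liu2002, Thm. 8.1.19 (a)] [cite: StacksProject, Tag 080A] [cite: StacksProject, Tag 080B] -/
theorem tangent_euclid_exponents (k β : ℕ) (hk : 2 ≤ k) (hβ : 1 ≤ β) : ∃ L : List (ℕ × ℕ),
    ∀ {R : Type u} [CommRing R] [IsRegularRing R] (t c η : R), IsUnit η →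
      IsQuasiRegular (![t, c] : Fin 2 → R) →
      IsRegularRing (R ⧸ Ideal.span (Set.range (![t, c] : Fin 2 → R))) →
      ∀ {Y : Scheme.{u}} {f : Y ⟶ Spec (.of R)},
        IsBlowup f (affineBlowup.idealSheaf
          (((Ideal.span {η * t + c ^ k} ⊔ Ideal.span {t ^ β}) *
            (L.map fun p : ℕ × ℕ =>
              Ideal.span {η * t + c ^ k} ^ p.1 ⊔ Ideal.span {c ^ (p.1 + p.2)}).prod) *
            Ideal.span (Set.range (![t, c] : Fin 2 → R)))) →
        Scheme.IsRegular Y := by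
  obtain ⟨k, rfl⟩ : ∃ k', k = k' + 1 + 1 := ⟨k - 2, by omega⟩
  obtain ⟨β, rfl⟩ : ∃ β', β = β' + 1 := ⟨β - 1, by omega⟩
  -- the Euclid list for `(1, (k+2)(β+1) - 1) = (1, (k+2)β + (k+1))`
  obtain ⟨L, hL⟩ := euclid_exponents.{u} 1 ((k + 1 + 1) * β + (k + 1))
  refine ⟨L, ?_⟩
  intro R _ _ t c η hη hx hR Y f hf
  haveI := hR
  refine isRegular_of_isBlowup_mul_of_charts (![t, c] : Fin 2 → R) _ (fun i => ?_) hf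
  have hi : i = 0 ∨ i = 1 := by
    fin_cases i
    · exact Or.inl rfl
    · exact Or.inr rfl
  rcases hi with rfl | rfl
  · -- the `t`-chart: everything is the Cartier divisor `(t^N)`
    intro Y' ρ hρ
    haveI hB : IsRegularRing (chartRing (![t, c] : Fin 2 → R) 0) :=
      isRegularRing_blowupChart _ 0 hx
    have hti : chartBase (![t, c] : Fin 2 → R) 0 t ∈
        nonZeroDivisors (chartRing (![t, c] : Fin 2 → R) 0) :=
      reesChartBase_mem_nonZeroDivisors ((![t, c] : Fin 2 → R) 0)
        (Ideal.mem_span_range_self (f := (![t, c] : Fin 2 → R)) (x := 0))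
    have hfac : ((L.map fun p : ℕ × ℕ => Ideal.span {η * t + c ^ (k + 1 + 1)} ^ p.1 ⊔
        Ideal.span {c ^ (p.1 + p.2)}).prod).map (chartBase (![t, c] : Fin 2 → R) 0) =
        Ideal.span {chartBase (![t, c] : Fin 2 → R) 0 t ^ (L.map Prod.fst).sum} := by
      rw [map_listProd]
      have hc : (L.map fun p : ℕ × ℕ => (Ideal.span {η * t + c ^ (k + 1 + 1)} ^ p.1 ⊔
          Ideal.span {c ^ (p.1 + p.2)}).map (chartBase (![t, c] : Fin 2 → R) 0)) =
          L.map fun p : ℕ × ℕ => Ideal.span {chartBase (![t, c] : Fin 2 → R) 0 t ^ p.1} := by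
        refine List.map_congr_left fun p _ => ?_
        exact map_chartBase_zero_tangentFactor t c η hη k p.1 p.2
      rw [hc]
      exact listProd_span_pow (chartBase (![t, c] : Fin 2 → R) 0 t) L Prod.fst
    have hpow : Ideal.span {chartBase (![t, c] : Fin 2 → R) 0 t} *
        Ideal.span {chartBase (![t, c] : Fin 2 → R) 0 t ^ (L.map Prod.fst).sum} =
        Ideal.span {chartBase (![t, c] : Fin 2 → R) 0 t *
          chartBase (![t, c] : Fin 2 → R) 0 t ^ (L.map Prod.fst).sum} * ⊤ := by
      rw [Ideal.mul_top, Ideal.span_singleton_mul_span_singleton]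
    rw [Ideal.map_mul, map_chartBase_zero_tangent t c η hη k β, hfac, hpow] at hρ
    refine CoreRungTower.isRegular_of_isBlowup_span_singleton_mul (mul_mem hti (pow_mem hti _)) _
      (fun Y'' ρ' hρ' => ?_) hρ
    rw [affineBlowup.idealSheaf_top] at hρ'
    haveI : IsIso ρ' := hρ'.isIso isEffectiveCartier_top
    haveI : IsRegularRing (CommRingCat.of (chartRing (![t, c] : Fin 2 → R) 0)) := hB
    exact SectionAscent.TraceIdeal.isRegular_of_iso (asIso ρ') (Scheme.isRegular_Spec _)
  · -- the `c`-chart: re-letter and run Euclid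
    intro Y' ρ hρ
    haveI hB : IsRegularRing (chartRing (![t, c] : Fin 2 → R) 1) :=
      isRegularRing_blowupChart _ 1 hx
    have hci : chartBase (![t, c] : Fin 2 → R) 1 c ∈
        nonZeroDivisors (chartRing (![t, c] : Fin 2 → R) 1) :=
      reesChartBase_mem_nonZeroDivisors ((![t, c] : Fin 2 → R) 1)
        (Ideal.mem_span_range_self (f := (![t, c] : Fin 2 → R)) (x := 1))
    -- images of `K` and of the avatars on the `c`-chart (part 1)
    have hK := map_chartBase_one_tangent t c η hη (k + 1) β
    have hfac : ((L.map fun p : ℕ × ℕ => Ideal.span {η * t + c ^ (k + 1 + 1)} ^ p.1 ⊔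
        Ideal.span {c ^ (p.1 + p.2)}).prod).map (chartBase (![t, c] : Fin 2 → R) 1) =
        Ideal.span {chartBase (![t, c] : Fin 2 → R) 1 c ^ (L.map Prod.fst).sum} *
          (L.map fun p : ℕ × ℕ => Ideal.span {(chartBase (![t, c] : Fin 2 → R) 1 η * chartGen (![t, c] : Fin 2 → R) 1 0 +
              chartBase (![t, c] : Fin 2 → R) 1 c ^ (k + 1))} ^ p.1 ⊔
            Ideal.span {chartBase (![t, c] : Fin 2 → R) 1 c ^ p.2}).prod := by
      rw [map_listProd]
      have hc : (L.map fun p : ℕ × ℕ => (Ideal.span {η * t + c ^ (k + 1 + 1)} ^ p.1 ⊔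
          Ideal.span {c ^ (p.1 + p.2)}).map (chartBase (![t, c] : Fin 2 → R) 1)) =
          L.map fun p : ℕ × ℕ => Ideal.span {chartBase (![t, c] : Fin 2 → R) 1 c ^ p.1} *
            (Ideal.span {(chartBase (![t, c] : Fin 2 → R) 1 η * chartGen (![t, c] : Fin 2 → R) 1 0 +
              chartBase (![t, c] : Fin 2 → R) 1 c ^ (k + 1))} ^ p.1 ⊔
              Ideal.span {chartBase (![t, c] : Fin 2 → R) 1 c ^ p.2}) :=
        List.map_congr_left fun p _ => map_chartBase_one_tangentFactor t c η (k + 1) p.1 p.2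
      rw [hc]
      exact listProd_twist (chartBase (![t, c] : Fin 2 → R) 1 c) L Prod.fst
        (fun p : ℕ × ℕ => Ideal.span {(chartBase (![t, c] : Fin 2 → R) 1 η * chartGen (![t, c] : Fin 2 → R) 1 0 +
              chartBase (![t, c] : Fin 2 → R) 1 c ^ (k + 1))} ^ p.1 ⊔
          Ideal.span {chartBase (![t, c] : Fin 2 → R) 1 c ^ p.2})
    have hpow : Ideal.span {chartBase (![t, c] : Fin 2 → R) 1 c} *
        (Ideal.span {(chartBase (![t, c] : Fin 2 → R) 1 η * chartGen (![t, c] : Fin 2 → R) 1 0 +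
              chartBase (![t, c] : Fin 2 → R) 1 c ^ (k + 1))} ⊔
          Ideal.span {chartBase (![t, c] : Fin 2 → R) 1 c ^ ((k + 1 + 1) * β + (k + 1))}) *
        (Ideal.span {chartBase (![t, c] : Fin 2 → R) 1 c ^ (L.map Prod.fst).sum} *
          (L.map fun p : ℕ × ℕ => Ideal.span {(chartBase (![t, c] : Fin 2 → R) 1 η * chartGen (![t, c] : Fin 2 → R) 1 0 +
              chartBase (![t, c] : Fin 2 → R) 1 c ^ (k + 1))} ^ p.1 ⊔
            Ideal.span {chartBase (![t, c] : Fin 2 → R) 1 c ^ p.2}).prod) =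
        Ideal.span {chartBase (![t, c] : Fin 2 → R) 1 c * chartBase (![t, c] : Fin 2 → R) 1 c ^ (L.map Prod.fst).sum} *
          ((Ideal.span {(chartBase (![t, c] : Fin 2 → R) 1 η * chartGen (![t, c] : Fin 2 → R) 1 0 +
              chartBase (![t, c] : Fin 2 → R) 1 c ^ (k + 1))} ⊔
            Ideal.span {chartBase (![t, c] : Fin 2 → R) 1 c ^ ((k + 1 + 1) * β + (k + 1))}) *
          (L.map fun p : ℕ × ℕ => Ideal.span {(chartBase (![t, c] : Fin 2 → R) 1 η * chartGen (![t, c] : Fin 2 → R) 1 0 +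
              chartBase (![t, c] : Fin 2 → R) 1 c ^ (k + 1))} ^ p.1 ⊔
            Ideal.span {chartBase (![t, c] : Fin 2 → R) 1 c ^ p.2}).prod) := by
      rw [mul_mul_mul_comm, Ideal.span_singleton_mul_span_singleton]
    rw [Ideal.map_mul] at hρ
    rw [hK] at hρ
    rw [hfac] at hρ
    rw [hpow] at hρ
    refine CoreRungTower.isRegular_of_isBlowup_span_singleton_mul (mul_mem hci (pow_mem hci _)) _
      (fun Y'' ρ' hρ' => ?_) hρ
    -- Euclid for the transversal pair `(c, h')`
    have hw : Ideal.span (Set.range (fun _ : Fin 1 => (chartBase (![t, c] : Fin 2 → R) 1 η * chartGen (![t, c] : Fin 2 → R) 1 0 +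
              chartBase (![t, c] : Fin 2 → R) 1 c ^ (k + 1)))) =
        Ideal.span {(chartBase (![t, c] : Fin 2 → R) 1 η * chartGen (![t, c] : Fin 2 → R) 1 0 +
              chartBase (![t, c] : Fin 2 → R) 1 c ^ (k + 1))} := by
      rw [Set.range_const]
    have hx' : IsQuasiRegular (Fin.cons (chartBase (![t, c] : Fin 2 → R) 1 c) (fun _ : Fin 1 => (chartBase (![t, c] : Fin 2 → R) 1 η * chartGen (![t, c] : Fin 2 → R) 1 0 +
              chartBase (![t, c] : Fin 2 → R) 1 c ^ (k + 1))) :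
        Fin 2 → chartRing (![t, c] : Fin 2 → R) 1) :=
      isQuasiRegular_of_isWeaklyRegular _ (isWeaklyRegular_exc_strict t c η hη hx k)
    have hR' := isRegularRing_quot_exc_strict t c η hη hx k
    have key := hL (chartBase (![t, c] : Fin 2 → R) 1 c) (fun _ : Fin 1 => (chartBase (![t, c] : Fin 2 → R) 1 η * chartGen (![t, c] : Fin 2 → R) 1 0 +
              chartBase (![t, c] : Fin 2 → R) 1 c ^ (k + 1))) hx' hR' (Y := Y'') (f := ρ')
    rw [hw, pow_one] at key
    exact key hρ'

end CoreRungTower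

end Summit.ResolutionOfSingularities.ResolutionOfSingularities.Theorems

end
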